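import Mathlib
import Summits.KontsevichZagierPeriods.Zeta5Search.TwoTaleOmega.FormalBarnesStep
import Summits.KontsevichZagierPeriods.Zeta5Search.TwoTaleOmega.FormalBarnesRes

/-!
# Formal Barnes functionals — instance KIT (the small generic lemmas every (bmiss)@Ω instance uses)

HONEST FRAMING: systematic search; no irrationality claim unless certified. Pure finite algebra over `ℚ`; no named
fact, no `sorry`.

Join point of the two generic chains (`…Step` = F8 recurrences of both tales, `…Res` = F10 residue criterion + block
ops). Collected here so that a per-direction instance (blueprint F10/F11, RECURRENCE.md §13.10–13.12) is instance work only: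

* truncation independence `lam0_eq_of_le`, `altE0_eq_of_le` (the degree parameter `d` may be taken uniform in a
  four-term recurrence whose members have different `dExp`);
* `PF.eval_shift`, `PF.poles_shift_subset`, `PF.eval_comb4`, `PF.poles_comb4_subset`, `PF.poles_sub_shift`
  (evaluating / locating the poles of both sides of a data identity `comb4 c v = G.shift.add (G.smul (−1))`);
* second tale: the formal residue IS a value, `altRes0_eq_eval : altRes0 M v = sgnZ M · v.eval M`, and
  `altRes1_eq_zero_of_notMem`;
* the block shift law `eval_block_succ_mul : block(t+1)·(t+lo) = block(t)·(t+hi)` for `FirstTale.block lo hi`.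
-/

open Finset Polynomial
open Literature.NumberTheory.Irrationality.Zudilin2014 (block)

namespace Summit.KontsevichZagierPeriods.Zeta5Search.FormalBarnes

/-! ### Truncation independence -/

/-- `Λ⁰` does not depend on the truncation `d ≥ deg`. -/
theorem lam0_eq_of_le (s : ℤ) (v : PF) {d d' : ℕ} (hd : v.poly.natDegree ≤ d) (hdd : d ≤ d') :
    lam0 d' s v = lam0 d s v := by
  unfold lam0; rw [lamPoly_eq_of_le v.poly _ hd hdd]

/-- `E⁰` does not depend on the truncation `d ≥ deg`. -/
theorem altE0_eq_of_le (M : ℤ) (v : PF) {d d' : ℕ} (hd : v.poly.natDegree ≤ d) (hdd : d ≤ d') :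
    altE0 d' M v = altE0 d M v := by
  unfold altE0; rw [ePoly_eq_of_le v.poly M hd hdd]

namespace PF

/-! ### Shift, four-term combinations: values and poles -/

/-- `(S v)(t) = v(t+1)`. -/
theorem eval_shift (v : PF) (t : ℚ) : v.shift.eval t = v.eval (t + 1) := by
  unfold PF.eval shift
  simp only
  rw [Polynomial.eval_comp, Polynomial.eval_add, Polynomial.eval_X, Polynomial.eval_one,
    Finsupp.sum_mapDomain_index_inj (add_left_injective 1), Finsupp.sum_mapDomain_index_inj (add_left_injective 1)]
  unfold Finsupp.sum
  push_cast
  congr 1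
  · congr 1
    exact sum_congr rfl fun k _ => by ring
  · exact sum_congr rfl fun k _ => by ring

/-- The poles of `S v` are the poles of `v` moved by `+1` (pole `t = −k` of `v` ↦ pole `t = −(k+1)` of `S v`). -/
theorem poles_shift_subset (v : PF) : v.shift.poles ⊆ v.poles.image (· + 1) := by
  intro k hk
  simp only [poles, shift, mem_union] at hk
  rw [poles, image_union, mem_union]
  rcases hk with h | h
  · exact Or.inl (Finsupp.mapDomain_support h)
  · exact Or.inr (Finsupp.mapDomain_support h)

/-- Value of a four-term combination. -/
theorem eval_comb4 (c : Fin 4 → ℚ) (v : Fin 4 → PF) (t : ℚ) :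
    (PF.comb4 c v).eval t = ∑ k : Fin 4, c k * (v k).eval t := by
  rw [Fin.sum_univ_four, PF.comb4, PF.eval_add, PF.eval_add, PF.eval_add, PF.eval_smul, PF.eval_smul, PF.eval_smul,
    PF.eval_smul]
  ring

/-- Poles of a four-term combination. -/
theorem poles_comb4_subset (c : Fin 4 → ℚ) (v : Fin 4 → PF) :
    (PF.comb4 c v).poles ⊆ ((v 0).poles ∪ (v 1).poles) ∪ ((v 2).poles ∪ (v 3).poles) := by
  refine (poles_add_subset _ _).trans (union_subset_union ?_ ?_)
  · exact (poles_add_subset _ _).trans (union_subset_union (poles_smul_subset _ _) (poles_smul_subset _ _))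
  · exact (poles_add_subset _ _).trans (union_subset_union (poles_smul_subset _ _) (poles_smul_subset _ _))

/-- Poles of the telescoped right-hand side `S G − G`. -/
theorem poles_shift_sub_subset (G : PF) : (G.shift.add (G.smul (-1))).poles ⊆ G.poles.image (· + 1) ∪ G.poles :=
  (poles_add_subset _ _).trans (union_subset_union (poles_shift_subset G) (poles_smul_subset _ _))

/-- Value of the telescoped right-hand side: `(S G − G)(t) = G(t+1) − G(t)`. -/
theorem eval_shift_sub (G : PF) (t : ℚ) : (G.shift.add (G.smul (-1))).eval t = G.eval (t + 1) - G.eval t := by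
  rw [PF.eval_add, PF.eval_smul, eval_shift]; ring

/-- Poles of the two-step telescoped right-hand side `S²G − G` (second tale). -/
theorem poles_shift2_sub_subset (G : PF) :
    (G.shift.shift.add (G.smul (-1))).poles ⊆ (G.poles.image (· + 1)).image (· + 1) ∪ G.poles :=
  (poles_add_subset _ _).trans (union_subset_union
    ((poles_shift_subset _).trans (image_subset_image (poles_shift_subset G))) (poles_smul_subset _ _))

/-- Value of the two-step telescoped right-hand side: `(S²G − G)(u) = G(u+2) − G(u)`. -/
theorem eval_shift2_sub (G : PF) (u : ℚ) :
    (G.shift.shift.add (G.smul (-1))).eval u = G.eval (u + 2) - G.eval u := by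
  rw [PF.eval_add, PF.eval_smul, eval_shift, eval_shift, add_assoc]; ring

/-- A membership helper: if every pole of `v` lies in `S` and `t` avoids `S`, then `t` avoids the poles. -/
theorem avoid_of_subset {v : PF} {S : Finset ℤ} (h : v.poles ⊆ S) {t : ℚ} (ht : ∀ k ∈ S, t + k ≠ 0) :
    ∀ k ∈ v.poles, t + k ≠ 0 := fun k hk => ht k (h hk)

end PF

/-! ### Second tale: the formal residue is a value -/

/-- `σ⁰_M(v) = (−1)^M · v(M)` — the junk-at-poles conventions of `altRes0` and `PF.eval` agree literally. -/
theorem altRes0_eq_eval (M : ℤ) (v : PF) : altRes0 M v = sgnZ M * v.eval (M : ℚ) := rfl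

/-- `σ¹_M(v) = 0` when `u = M` is not a pole (a support fact). -/
theorem altRes1_eq_zero_of_notMem {v : PF} {M : ℤ} (h : -M ∉ v.poles) : altRes1 M v = 0 := by
  unfold altRes1; rw [PF.double_eq_zero_of_notMem h, mul_zero]

/-- If `u = M` is not a pole and `v(M) = 0` then `σ⁰_M(v) = 0`. -/
theorem altRes0_eq_zero_of_eval {v : PF} {M : ℤ} (h : v.eval (M : ℚ) = 0) : altRes0 M v = 0 := by
  rw [altRes0_eq_eval, h, mul_zero]

/-! ### Block shift law -/

/-- `∏_{i<n} (t+1+lo+i) · (t+lo) = ∏_{i<n} (t+lo+i) · (t+lo+n)`. -/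
theorem prod_range_succ_shift (lo : ℤ) (n : ℕ) (t : ℚ) :
    (∏ i ∈ range n, (t + 1 + ((lo + i : ℤ) : ℚ))) * (t + lo) = (∏ i ∈ range n, (t + ((lo + i : ℤ) : ℚ))) * (t + ((lo + n : ℤ) : ℚ)) := by
  have h1 := prod_range_succ (fun i : ℕ => t + ((lo + i : ℤ) : ℚ)) n
  have h2 := prod_range_succ' (fun i : ℕ => t + ((lo + i : ℤ) : ℚ)) n
  have h3 : ∏ i ∈ range n, (t + 1 + ((lo + i : ℤ) : ℚ)) = ∏ i ∈ range n, (t + ((lo + (i + 1 : ℕ) : ℤ) : ℚ)) :=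
    prod_congr rfl fun i _ => by push_cast; ring
  have h0 : (t + (lo : ℚ)) = t + ((lo + (0 : ℕ) : ℤ) : ℚ) := by push_cast; ring
  rw [h3, h0, ← h2, h1]

/-- **Block shift law**: `block lo hi (t+1) · (t+lo) = block lo hi (t) · (t+hi)` for `lo ≤ hi`. -/
theorem eval_block_succ_mul {lo hi : ℤ} (h : lo ≤ hi) (t : ℚ) :
    (block lo hi).eval (t + 1) * (t + lo) = (block lo hi).eval t * (t + hi) := by
  obtain ⟨n, rfl⟩ : ∃ n : ℕ, hi = lo + n := ⟨(hi - lo).toNat, by rw [Int.toNat_of_nonneg (sub_nonneg.2 h)]; ring⟩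
  rw [← PF.prod_range_eq_eval_block, ← PF.prod_range_eq_eval_block]
  exact prod_range_succ_shift lo n t

end Summit.KontsevichZagierPeriods.Zeta5Search.FormalBarnes
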